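import Mathlib
import Literature.MathematicalPhysics.StatisticalMechanics.HaggStacking

/-!
# Route PricedLinkCensus — sitewise even-alignment domination (word column of `StackingHinge`)
(stub `stub_sitewiseEvenAlignmentDomination` of line Sketch, stmt-AtomisticToContinuum-14993)

For a Hägg word `s : ℤ → {±1}`, a layer `m`, a truncation `K` and couplings `J₂ ≤ J₃ ≤ ⋯ ≤ 0`
(non-positive and non-decreasing from `k = 2` on), the truncated local Hägg energy
`haggLocalEnergyTrunc K J s m = ∑_{k=2}^{K} J_k · 1[layers m, m+k aligned]` is bounded BELOW, at
every site, by that of the alternating word (hcp, `∑_{k even ≤ K} J_k`), and the deficit is at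
least `J₃ − J₂` when `K ≥ 3` and layers `m`, `m + 2` are not aligned.

Proof (block argument).  Consecutive windows of a Hägg word differ by `±1`, so two consecutive
ranges `k`, `k + 1` are never both aligned (`not_haggAligned_succ`).  Hence over a block
`{K+1, K+2}` the energy of `s` grows by at least `J_{K+1}` (`le_haggLocalEnergyTrunc_succ_succ`),
while from an ODD range `K` the alternating energy grows by exactly `J_{K+1}`; an inequality
`alt K + c ≤ f K` at an odd range therefore propagates to all larger odd ranges (`chain`) and one
step further to the even ranges (`step_even`).  The two clauses are the chains started at
`K = 1` (`c = 0`, both sides vanish) and at `K = 3` (`c = J₃ − J₂`, range `2` not aligned).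

All `[folklore]`; only `Literature/MathematicalPhysics/StatisticalMechanics/HaggStacking.lean` and
finite sums are used.
-/

namespace Summit.AtomisticToContinuum.Crystallization.Theorems.PricedHcpWindowsSitewise

open Literature.MathematicalPhysics.StatisticalMechanics

/-! ### No two consecutive aligned ranges -/

/-- In a Hägg word two consecutive windows are never both aligned: the window sums differ by
`s (m + k) = ±1`, so they are not both `≡ 0 (mod 3)`. [folklore] -/
theorem not_haggAligned_succ {s : ℤ → ℤ} (hs : IsHaggSeq s) (m : ℤ) (k : ℕ)
    (h : HaggAligned s m k) : ¬ HaggAligned s m (k + 1) := by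
  simp only [HaggAligned] at h ⊢
  rw [haggWindow_succ]
  rcases hs (m + k) with h1 | h1 <;> rw [h1] <;> omega

/-! ### Recursion of the truncated local energy in the range -/

/-- The truncated local energy vanishes for `K ≤ 1` (empty range of summation). [folklore] -/
theorem haggLocalEnergyTrunc_of_le_one {K : ℕ} (hK : K ≤ 1) (J : ℕ → ℝ) (s : ℤ → ℤ) (m : ℤ) :
    haggLocalEnergyTrunc K J s m = 0 := by
  unfold haggLocalEnergyTrunc
  rw [Finset.Icc_eq_empty (show ¬ (2 : ℕ) ≤ K by omega), Finset.sum_empty]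

/-- One-step recursion in the range: `f (K+1) = f K + J_{K+1} · 1[range K+1 aligned]` (`K ≥ 1`).
[folklore] -/
theorem haggLocalEnergyTrunc_succ {K : ℕ} (hK : 1 ≤ K) (J : ℕ → ℝ) (s : ℤ → ℤ) (m : ℤ) :
    haggLocalEnergyTrunc (K + 1) J s m =
      haggLocalEnergyTrunc K J s m + if HaggAligned s m (K + 1) then J (K + 1) else 0 := by
  unfold haggLocalEnergyTrunc
  exact Finset.sum_Icc_succ_top (by omega) _

/-- One-step lower bound: `f K + J_{K+1} ≤ f (K+1)` when `J_{K+1} ≤ 0` (`K ≥ 1`). [folklore] -/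
theorem le_haggLocalEnergyTrunc_succ {K : ℕ} (hK : 1 ≤ K) (J : ℕ → ℝ) (s : ℤ → ℤ) (m : ℤ)
    (hJ : J (K + 1) ≤ 0) :
    haggLocalEnergyTrunc K J s m + J (K + 1) ≤ haggLocalEnergyTrunc (K + 1) J s m := by
  rw [haggLocalEnergyTrunc_succ hK]
  split_ifs <;> linarith

/-- **Block lower bound**: `f K + J_{K+1} ≤ f (K+2)` for a Hägg word (`K ≥ 1`,
`J_{K+1} ≤ J_{K+2} ≤ 0`): at most one of the ranges `K+1`, `K+2` is aligned. [folklore] -/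
theorem le_haggLocalEnergyTrunc_succ_succ {K : ℕ} (hK : 1 ≤ K) (J : ℕ → ℝ) {s : ℤ → ℤ}
    (hs : IsHaggSeq s) (m : ℤ) (hJ0 : J (K + 2) ≤ 0) (hJm : J (K + 1) ≤ J (K + 2)) :
    haggLocalEnergyTrunc K J s m + J (K + 1) ≤ haggLocalEnergyTrunc (K + 2) J s m := by
  have e : haggLocalEnergyTrunc (K + 2) J s m = haggLocalEnergyTrunc (K + 1) J s m +
      if HaggAligned s m (K + 2) then J (K + 2) else 0 :=
    haggLocalEnergyTrunc_succ (K := K + 1) (by omega) J s m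
  rw [e, haggLocalEnergyTrunc_succ hK]
  by_cases h1 : HaggAligned s m (K + 1)
  · have h2 : ¬ HaggAligned s m (K + 2) := not_haggAligned_succ hs m (K + 1) h1
    rw [if_pos h1, if_neg h2]
    linarith
  · rw [if_neg h1]
    split_ifs <;> linarith

/-! ### The alternating word -/

/-- Alternating word, even range: `alt (2p+2) = alt (2p+1) + J_{2p+2}`. [folklore] -/
theorem haggLocalEnergyTrunc_alternating_even_succ (p : ℕ) (J : ℕ → ℝ) (m : ℤ) :
    haggLocalEnergyTrunc (2 * p + 2) J alternatingHagg m =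
      haggLocalEnergyTrunc (2 * p + 1) J alternatingHagg m + J (2 * p + 2) := by
  have e : haggLocalEnergyTrunc (2 * p + 2) J alternatingHagg m =
      haggLocalEnergyTrunc (2 * p + 1) J alternatingHagg m +
        if HaggAligned alternatingHagg m (2 * p + 2) then J (2 * p + 2) else 0 :=
    haggLocalEnergyTrunc_succ (K := 2 * p + 1) (by omega) J alternatingHagg m
  rw [e, if_pos ((haggAligned_alternating_iff m (2 * p + 2)).mpr ⟨p + 1, by ring⟩)]

/-- Alternating word, odd range: `alt (2p+3) = alt (2p+2)`. [folklore] -/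
theorem haggLocalEnergyTrunc_alternating_odd_succ (p : ℕ) (J : ℕ → ℝ) (m : ℤ) :
    haggLocalEnergyTrunc (2 * p + 3) J alternatingHagg m =
      haggLocalEnergyTrunc (2 * p + 2) J alternatingHagg m := by
  have e : haggLocalEnergyTrunc (2 * p + 3) J alternatingHagg m =
      haggLocalEnergyTrunc (2 * p + 2) J alternatingHagg m +
        if HaggAligned alternatingHagg m (2 * p + 3) then J (2 * p + 3) else 0 :=
    haggLocalEnergyTrunc_succ (K := 2 * p + 2) (by omega) J alternatingHagg m
  have hne : ¬ Even (2 * p + 3) := by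
    rw [Nat.even_iff]
    omega
  rw [e, if_neg (fun h => hne ((haggAligned_alternating_iff m (2 * p + 3)).mp h)), add_zero]

/-! ### Propagation of the domination along the ranges -/

/-- **Even step**: a domination `alt (2p+1) + c ≤ f (2p+1)` at an odd range passes to the next
(even) range, since `alt` grows by `J_{2p+2}` and `f` by at least `J_{2p+2}`. [folklore] -/
theorem step_even (p : ℕ) (J : ℕ → ℝ) (s : ℤ → ℤ) (m : ℤ) (c : ℝ) (hJ0 : J (2 * p + 2) ≤ 0)
    (h : haggLocalEnergyTrunc (2 * p + 1) J alternatingHagg m + c ≤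
      haggLocalEnergyTrunc (2 * p + 1) J s m) :
    haggLocalEnergyTrunc (2 * p + 2) J alternatingHagg m + c ≤
      haggLocalEnergyTrunc (2 * p + 2) J s m := by
  have h1 : haggLocalEnergyTrunc (2 * p + 1) J s m + J (2 * p + 2) ≤
      haggLocalEnergyTrunc (2 * p + 2) J s m :=
    le_haggLocalEnergyTrunc_succ (K := 2 * p + 1) (by omega) J s m hJ0
  rw [haggLocalEnergyTrunc_alternating_even_succ p J m]
  linarith

/-- **Odd double step**: a domination `alt (2p+1) + c ≤ f (2p+1)` at an odd range passes to the
next odd range `2p+3`, since `alt` grows by `J_{2p+2}` and `f` by at least `J_{2p+2}` over the block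
`{2p+2, 2p+3}`. [folklore] -/
theorem step_odd (p : ℕ) (J : ℕ → ℝ) {s : ℤ → ℤ} (hs : IsHaggSeq s) (m : ℤ) (c : ℝ)
    (hJ0 : J (2 * p + 3) ≤ 0) (hJm : J (2 * p + 2) ≤ J (2 * p + 3))
    (h : haggLocalEnergyTrunc (2 * p + 1) J alternatingHagg m + c ≤
      haggLocalEnergyTrunc (2 * p + 1) J s m) :
    haggLocalEnergyTrunc (2 * p + 3) J alternatingHagg m + c ≤
      haggLocalEnergyTrunc (2 * p + 3) J s m := by
  have h1 : haggLocalEnergyTrunc (2 * p + 1) J s m + J (2 * p + 2) ≤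
      haggLocalEnergyTrunc (2 * p + 3) J s m :=
    le_haggLocalEnergyTrunc_succ_succ (K := 2 * p + 1) (by omega) J hs m hJ0 hJm
  rw [haggLocalEnergyTrunc_alternating_odd_succ p J m,
    haggLocalEnergyTrunc_alternating_even_succ p J m]
  linarith

/-- **Chain**: a domination `alt (2p₀+1) + c ≤ f (2p₀+1)` at an odd range propagates to every
larger odd range `2(p₀+n)+1`. [folklore] -/
theorem chain (p₀ : ℕ) (J : ℕ → ℝ) {s : ℤ → ℤ} (hs : IsHaggSeq s) (m : ℤ) (c : ℝ)
    (hJ0 : ∀ k : ℕ, 2 ≤ k → J k ≤ 0) (hJm : ∀ k : ℕ, 2 ≤ k → J k ≤ J (k + 1))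
    (h : haggLocalEnergyTrunc (2 * p₀ + 1) J alternatingHagg m + c ≤
      haggLocalEnergyTrunc (2 * p₀ + 1) J s m) (n : ℕ) :
    haggLocalEnergyTrunc (2 * (p₀ + n) + 1) J alternatingHagg m + c ≤
      haggLocalEnergyTrunc (2 * (p₀ + n) + 1) J s m := by
  induction n with
  | zero => simpa using h
  | succ n ih =>
    have e : 2 * (p₀ + (n + 1)) + 1 = 2 * (p₀ + n) + 3 := by ring
    rw [e]
    exact step_odd (p₀ + n) J hs m c (hJ0 (2 * (p₀ + n) + 3) (by omega))
      (hJm (2 * (p₀ + n) + 2) (by omega)) ih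

/-! ### Base cases -/

/-- Base of the first chain: at range `1` both energies vanish. [folklore] -/
theorem base_one (J : ℕ → ℝ) (s : ℤ → ℤ) (m : ℤ) :
    haggLocalEnergyTrunc 1 J alternatingHagg m + 0 ≤ haggLocalEnergyTrunc 1 J s m := by
  have h1 : haggLocalEnergyTrunc 1 J alternatingHagg m = 0 :=
    haggLocalEnergyTrunc_of_le_one le_rfl J _ m
  have h2 : haggLocalEnergyTrunc 1 J s m = 0 := haggLocalEnergyTrunc_of_le_one le_rfl J s m
  rw [h1, h2, add_zero]

/-- Base of the second chain: at range `3`, if range `2` is not aligned, `alt 3 + (J₃ − J₂) = J₃ ≤ f 3`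
(`f 3 = J₃ · 1[range 3 aligned] ≥ J₃` as `J₃ ≤ 0`). [folklore] -/
theorem base_three (J : ℕ → ℝ) {s : ℤ → ℤ} (m : ℤ) (hJ3 : J 3 ≤ 0) (h2 : ¬ HaggAligned s m 2) :
    haggLocalEnergyTrunc 3 J alternatingHagg m + (J 3 - J 2) ≤ haggLocalEnergyTrunc 3 J s m := by
  have e1 : haggLocalEnergyTrunc 3 J alternatingHagg m = haggLocalEnergyTrunc 2 J alternatingHagg m :=
    haggLocalEnergyTrunc_alternating_odd_succ 0 J m
  have e2 : haggLocalEnergyTrunc 2 J alternatingHagg m =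
      haggLocalEnergyTrunc 1 J alternatingHagg m + J 2 :=
    haggLocalEnergyTrunc_alternating_even_succ 0 J m
  have e3 : haggLocalEnergyTrunc 1 J alternatingHagg m = 0 :=
    haggLocalEnergyTrunc_of_le_one le_rfl J _ m
  have e4 : haggLocalEnergyTrunc 1 J s m = 0 := haggLocalEnergyTrunc_of_le_one le_rfl J s m
  have e5 : haggLocalEnergyTrunc 2 J s m =
      haggLocalEnergyTrunc 1 J s m + if HaggAligned s m 2 then J 2 else 0 :=
    haggLocalEnergyTrunc_succ le_rfl J s m
  have e6 : haggLocalEnergyTrunc 3 J s m =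
      haggLocalEnergyTrunc 2 J s m + if HaggAligned s m 3 then J 3 else 0 :=
    haggLocalEnergyTrunc_succ (by norm_num) J s m
  rw [if_neg h2] at e5
  rw [e1, e2, e3, e6, e5, e4]
  split_ifs <;> linarith

/-! ### The domination lemma -/

/-- **Sitewise even-alignment domination** (word column of the priced hcp-window inequality).  For a
Hägg word `s`, a layer `m`, a truncation `K` and couplings `J` with `J k ≤ 0` and `J k ≤ J (k+1)` for
`k ≥ 2`: (1) the truncated local Hägg energy of the alternating word (hcp, `∑_{k even ≤ K} J_k`) is
a lower bound for that of `s` at `m`; (2) if `K ≥ 3` and layers `m`, `m+2` are not aligned, the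
deficit is at least `J 3 − J 2`.  Proof: the chains `chain 0` (base `base_one`) and `chain 1` (base
`base_three`) give the odd ranges, `step_even` the even ones. [folklore] -/
theorem stub_sitewiseEvenAlignmentDomination : ∀ (K : ℕ) (J : ℕ → ℝ) (s : ℤ → ℤ) (m : ℤ), Literature.MathematicalPhysics.StatisticalMechanics.IsHaggSeq s → (∀ k : ℕ, 2 ≤ k → J k ≤ 0) → (∀ k : ℕ, 2 ≤ k → J k ≤ J (k + 1)) → Literature.MathematicalPhysics.StatisticalMechanics.haggLocalEnergyTrunc K J Literature.MathematicalPhysics.StatisticalMechanics.alternatingHagg m ≤ Literature.MathematicalPhysics.StatisticalMechanics.haggLocalEnergyTrunc K J s m ∧ (3 ≤ K → ¬ Literature.MathematicalPhysics.StatisticalMechanics.HaggAligned s m 2 → Literature.MathematicalPhysics.StatisticalMechanics.haggLocalEnergyTrunc K J Literature.MathematicalPhysics.StatisticalMechanics.alternatingHagg m + (J 3 - J 2) ≤ Literature.MathematicalPhysics.StatisticalMechanics.haggLocalEnergyTrunc K J s m) := by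
  intro K J s m hs hJ0 hJm
  -- odd ranges, clause 1: the chain started at range 1
  have hodd1 : ∀ n : ℕ, haggLocalEnergyTrunc (2 * n + 1) J alternatingHagg m ≤
      haggLocalEnergyTrunc (2 * n + 1) J s m := by
    intro n
    have := chain 0 J hs m 0 hJ0 hJm (base_one J s m) n
    simpa using this
  -- odd ranges `≥ 3`, clause 2: the chain started at range 3
  have hodd3 : ¬ HaggAligned s m 2 → ∀ n : ℕ,
      haggLocalEnergyTrunc (2 * (n + 1) + 1) J alternatingHagg m + (J 3 - J 2) ≤
        haggLocalEnergyTrunc (2 * (n + 1) + 1) J s m := by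
    intro h2 n
    have := chain 1 J hs m (J 3 - J 2) hJ0 hJm (base_three J m (hJ0 3 (by norm_num)) h2) n
    rw [add_comm 1 n] at this
    exact this
  obtain ⟨n, rfl | rfl⟩ := Nat.even_or_odd' K
  · -- even range `K = 2n`
    cases n with
    | zero =>
      have h0 : ∀ t : ℤ → ℤ, haggLocalEnergyTrunc (2 * 0) J t m = 0 :=
        fun t => haggLocalEnergyTrunc_of_le_one (by norm_num) J t m
      exact ⟨(h0 alternatingHagg).le.trans (h0 s).ge, fun h => absurd h (by norm_num)⟩
    | succ p =>
      rw [show 2 * (p + 1) = 2 * p + 2 by ring]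
      refine ⟨?_, fun hK h2 => ?_⟩
      · have := step_even p J s m 0 (hJ0 _ (by omega)) (by simpa using hodd1 p)
        simpa using this
      · obtain ⟨q, rfl⟩ : ∃ q, p = q + 1 := ⟨p - 1, by omega⟩
        exact step_even (q + 1) J s m (J 3 - J 2) (hJ0 _ (by omega)) (hodd3 h2 q)
  · -- odd range `K = 2n+1`
    refine ⟨hodd1 n, fun hK h2 => ?_⟩
    obtain ⟨q, rfl⟩ : ∃ q, n = q + 1 := ⟨n - 1, by omega⟩
    exact hodd3 h2 q

end Summit.AtomisticToContinuum.Crystallization.Theorems.PricedHcpWindowsSitewise
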